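import Mathlib.Topology.Separation.Basic
import Mathlib.Topology.Compactness.Compact
import Mathlib.Topology.Clopen
import Mathlib.Topology.Connected.Clopen
import Mathlib.Topology.GDelta.Basic
import HarnessLib

/-!
# A closed subset which at each of its points is either a neighbourhood or isolated is, on a connected space, EVERYTHING or DISCRETE; if
# moreover it contains or avoids each of a family of open «ends» whose complement is compact, it is EVERYTHING or FINITE
# (the topology of «a closed analytic subset of a connected curve is the curve or a discrete set»; the one-dimensional reduction of
# Cattani–Deligne–Kaplan's Theorem 1.1 / Corollary 1.2)

Topic `Literature/Topology` (namespace `Literature.Topology`).  THEOREMS ONLY (no definition, no named fact, no instance; D-0026 net debt `0`).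

THE PRINTED STATEMENTS THIS ABSTRACTS.  K. Fritzsche, H. Grauert, *From Holomorphic Functions to Complex Manifolds* (GTM 213, 2002), Ch. I §8,
after Prop. 8.1: «If `n = 1`, then a nowhere dense analytic set consists only of isolated points» — in one variable the germ at `x` of an
analytic set `A` is the germ of the whole space or `A ∖ {x}` avoids a punctured neighbourhood of `x` (identity principle), and a connected curve
splits accordingly.  E. Cattani, P. Deligne, A. Kaplan, *On the locus of Hodge classes*, J. AMS 8 (1995), §1 (p. 484): «locally on `S`, `S^{(K)}` is
a finite disjoint sum of closed analytic subspaces», Theorem 1.1 «`S^{(K)}` is an algebraic variety, finite over `S`», Corollary 1.2 «The germ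
of analytic subvariety of `S` where `u` remains of type `(0, 0)` is algebraic», and the reduction «Proof of 1.5 ⟹ 1.1» (p. 485): cover a smooth
compactification `S̄` by the interior and finitely many neighbourhoods of the points at infinity, where Thm. 1.5 applies.  For a CURVE `S`
(`S̄ ∖ S` finite) an algebraic subset is `S` or finite, and this file isolates the topology of that conclusion:

* §1 `isClosed_of_forall_mem_nhds_or_eventually_not_mem` — a set which at EVERY point of the space is a neighbourhood or punctured-avoided
  is closed; `isClopen_interior_of_forall_mem` — for `Z` closed and, at each of ITS points, a neighbourhood or isolated, `interior Z` is clopen;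
* §2 `eq_univ_or_forall_eventually_not_mem` — on a preconnected space such a `Z` is the whole space or DISCRETE (every point of the space
  has a punctured neighbourhood avoiding `Z`);
* §3 `Set.Finite.of_isClosed_of_subset_isCompact_of_forall_eventually_not_mem` — a closed discrete set inside a compact set is finite;
* §5 (several variables) `isClopen_interior_of_forall_exists_mem_nhds`, **`eq_univ_or_interior_eq_empty`**, `eq_univ_or_isNowhereDense` —
  near every point a neighbourhood inside `Z` or empty interior ⟹ `Z` is everything or has empty interior (nowhere dense if closed);
* §4 **`eq_univ_or_finite_of_forall_mem_nhds_or_eventually_not_mem`** — if moreover `Z ⊆ C ∪ ⋃ᵢ Eᵢ` with `C` compact and each `Eᵢ` OPEN and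
  either contained in `Z` or disjoint from it («above `U`, `S^{(K)}` is a finite disjoint sum of traces of closed analytic subspaces of `U`»
  at each point at infinity, one variable: the trace through the puncture is the punctured disc or, after shrinking, empty), then
  **`Z` is the whole space or finite**; `…_of_forall` — the variant with the dichotomy assumed at every point (closedness derived).

## References

* [FritzscheGrauert2002] K. Fritzsche, H. Grauert, *From Holomorphic Functions to Complex Manifolds*, GTM 213, Springer 2002, Ch. I §8
  (remark after Prop. 8.1, case `n = 1`).
* [CattaniDeligneKaplan1995] E. Cattani, P. Deligne, A. Kaplan, *On the locus of Hodge classes*, J. Amer. Math. Soc. 8 (1995) 483–506: §1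
  (p. 484), Thm. 1.1, Cor. 1.2, «Proof of 1.5 ⟹ 1.1» (p. 485).
-/

open _root_.Topology _root_.Filter Set

namespace Literature.Topology

variable {X : Type*} [TopologicalSpace X]

/-! ## §1 Closedness, and the interior is clopen -/

/-- **A set which, at every point of the space, is either a neighbourhood of the point or avoided by a punctured neighbourhood of it, is
closed** (at a point outside `Z` the first alternative is impossible, so a whole neighbourhood avoids `Z`).
[cite: FritzscheGrauert2002, Ch. I §8 (after Prop. 8.1, n = 1)] -/
theorem isClosed_of_forall_mem_nhds_or_eventually_not_mem {Z : Set X} (h : ∀ x : X, Z ∈ 𝓝 x ∨ ∀ᶠ y in 𝓝[≠] x, y ∉ Z) : IsClosed Z := by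
  rw [← isOpen_compl_iff, isOpen_iff_mem_nhds]
  intro x hx
  rcases h x with hZ | hZ
  · exact absurd (mem_of_mem_nhds hZ) hx
  · have h' : ∀ᶠ y in 𝓝 x, y ∈ ({x} : Set X)ᶜ → y ∉ Z := eventually_nhdsWithin_iff.1 hZ
    filter_upwards [h'] with y hy
    by_cases hyx : y = x
    · rw [hyx]; exact hx
    · exact hy (mem_compl_singleton_iff.2 hyx)

/-- **For `Z` closed and, at each of its points, a neighbourhood or isolated, the interior of `Z` is CLOPEN**: a limit `x` of interior points
lies in `Z`; were `x` isolated in `Z`, a punctured neighbourhood of `x` would avoid `Z`, hence avoid the interior points accumulating at `x`.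
[cite: FritzscheGrauert2002, Ch. I §8 (after Prop. 8.1, n = 1)] -/
theorem isClopen_interior_of_forall_mem {Z : Set X} (hZ : IsClosed Z) (h : ∀ x ∈ Z, Z ∈ 𝓝 x ∨ ∀ᶠ y in 𝓝[≠] x, y ∉ Z) :
    IsClopen (interior Z) := by
  refine ⟨?_, isOpen_interior⟩
  rw [isClosed_iff_clusterPt]
  intro x hx
  -- `x ∈ closure (interior Z) ⊆ closure Z = Z`
  have hxZ : x ∈ Z := hZ.closure_subset (closure_mono interior_subset (mem_closure_iff_clusterPt.2 hx))
  rcases h x hxZ with hn | hiso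
  · exact mem_interior_iff_mem_nhds.2 hn
  · -- a punctured neighbourhood `U ∖ {x}` of `x` avoids `Z ⊇ interior Z`, while `U` meets `interior Z`: the meeting point is `x`
    rw [clusterPt_principal_iff] at hx
    obtain ⟨U, hU, hUZ⟩ := (eventually_nhdsWithin_iff.1 hiso).exists_mem
    obtain ⟨y, hyU, hyint⟩ := hx U hU
    by_cases hyx : y = x
    · rw [← hyx]; exact hyint
    · exact absurd (interior_subset hyint) (hUZ y hyU (mem_compl_singleton_iff.2 hyx))

/-! ## §2 On a preconnected space: everything or discrete -/

/-- **EVERYTHING OR DISCRETE.**  On a preconnected space, a closed set `Z` which at each of its points is a neighbourhood or isolated is either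
the whole space, or such that EVERY point of the space has a punctured neighbourhood avoiding `Z` («if `n = 1`, then a nowhere dense analytic
set consists only of isolated points»: `interior Z` is clopen, hence empty or everything).
[cite: FritzscheGrauert2002, Ch. I §8 (after Prop. 8.1, n = 1)] -/
theorem eq_univ_or_forall_eventually_not_mem [PreconnectedSpace X] {Z : Set X} (hZ : IsClosed Z)
    (h : ∀ x ∈ Z, Z ∈ 𝓝 x ∨ ∀ᶠ y in 𝓝[≠] x, y ∉ Z) : Z = univ ∨ ∀ x : X, ∀ᶠ y in 𝓝[≠] x, y ∉ Z := by
  rcases isClopen_iff.1 (isClopen_interior_of_forall_mem hZ h) with h0 | h1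
  · refine Or.inr fun x => ?_
    by_cases hx : x ∈ Z
    · rcases h x hx with hn | hiso
      · have : x ∈ interior Z := mem_interior_iff_mem_nhds.2 hn
        rw [h0] at this
        exact absurd this (notMem_empty x)
      · exact hiso
    · exact mem_nhdsWithin_of_mem_nhds (hZ.isOpen_compl.mem_nhds hx)
  · exact Or.inl (eq_univ_of_univ_subset (h1.symm.le.trans interior_subset))

/-- The same dichotomy recorded with the interior: `interior Z = univ` (so `Z = univ`) or `interior Z = ∅` and every point of `Z` is isolated
in `Z`. [cite: FritzscheGrauert2002, Ch. I §8 (after Prop. 8.1, n = 1)] -/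
theorem interior_eq_univ_or_interior_eq_empty [PreconnectedSpace X] {Z : Set X} (hZ : IsClosed Z)
    (h : ∀ x ∈ Z, Z ∈ 𝓝 x ∨ ∀ᶠ y in 𝓝[≠] x, y ∉ Z) :
    interior Z = univ ∨ (interior Z = ∅ ∧ ∀ x ∈ Z, ∀ᶠ y in 𝓝[≠] x, y ∉ Z) := by
  rcases isClopen_iff.1 (isClopen_interior_of_forall_mem hZ h) with h0 | h1
  · refine Or.inr ⟨h0, fun x hx => (h x hx).resolve_left fun hn => ?_⟩
    have : x ∈ interior Z := mem_interior_iff_mem_nhds.2 hn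
    rw [h0] at this
    exact notMem_empty x this
  · exact Or.inl h1

/-! ## §3 Closed, discrete and inside a compact set: finite -/

/-- **A closed set, every point of which is isolated in it, contained in a compact set, is finite** (cover the compact set `Z` by
neighbourhoods meeting `Z` in at most their centre and extract a finite subcover). [cite: FritzscheGrauert2002, Ch. I §8 (after Prop. 8.1, n = 1)] -/
theorem _root_.Set.Finite.of_isClosed_of_subset_isCompact_of_forall_eventually_not_mem {Z C : Set X} (hZ : IsClosed Z) (hC : IsCompact C)
    (hZC : Z ⊆ C) (h : ∀ x ∈ Z, ∀ᶠ y in 𝓝[≠] x, y ∉ Z) : Z.Finite := by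
  have hZc : IsCompact Z := hC.of_isClosed_subset hZ hZC
  -- neighbourhoods `U x` of the points `x ∈ Z` meeting `Z` at most in `x`
  have hex : ∀ x ∈ Z, ∃ U ∈ 𝓝 x, ∀ y ∈ U, y ∈ ({x} : Set X)ᶜ → y ∉ Z := fun x hx => (eventually_nhdsWithin_iff.1 (h x hx)).exists_mem
  choose U hU hUZ using hex
  obtain ⟨t, hcover⟩ := hZc.elim_nhds_subcover' (fun x hx => U x hx) fun x hx => hU x hx
  refine (t.finite_toSet.image (Subtype.val : Z → X)).subset fun z hz => ?_
  have hz' := hcover hz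
  simp only [mem_iUnion] at hz'
  obtain ⟨x, hxt, hzx⟩ := hz'
  refine ⟨x, Finset.mem_coe.2 hxt, ?_⟩
  by_contra hne
  exact hUZ x.1 x.2 z hzx (mem_compl_singleton_iff.2 (Ne.symm hne)) hz

/-! ## §4 Everything or finite -/

/-- **EVERYTHING OR FINITE.**  On a preconnected space `X`, let `Z` be closed and, at each of its points, a neighbourhood or isolated; suppose
`Z ⊆ C ∪ ⋃ᵢ Eᵢ` with `C` compact and every «end» `Eᵢ` OPEN and either contained in `Z` or disjoint from it.  Then **`Z = X` or `Z` is finite**: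
if `interior Z ≠ ∅` it is everything (clopen); otherwise no nonempty open `Eᵢ` lies in `Z`, so every end is disjoint from `Z`, and `Z ⊆ C` is
closed, discrete and compact.  This is the topology of «`S^{(K)}` is an algebraic variety, finite over `S`» / «the germ of analytic subvariety
of `S` where `u` remains of type `(0, 0)` is algebraic» over a CURVE `S = S̄ ∖ {finitely many points}`: the interior dichotomy is the identity
principle in local period charts, the ends are punctured neighbourhoods of the points at infinity, where Thm. 1.5 gives «contains or avoids».
[cite: CattaniDeligneKaplan1995, Thm. 1.1, Cor. 1.2 (p. 484) and «Proof of 1.5 ⟹ 1.1» (p. 485)] [cite: FritzscheGrauert2002, Ch. I §8 (after Prop. 8.1, n = 1)] -/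
theorem eq_univ_or_finite_of_forall_mem_nhds_or_eventually_not_mem [PreconnectedSpace X] {Z : Set X} (hZ : IsClosed Z)
    (h : ∀ x ∈ Z, Z ∈ 𝓝 x ∨ ∀ᶠ y in 𝓝[≠] x, y ∉ Z) {C : Set X} (hC : IsCompact C) {ι : Sort*} {E : ι → Set X}
    (hE : ∀ i, IsOpen (E i)) (hcover : Z ⊆ C ∪ ⋃ i, E i) (hend : ∀ i, E i ⊆ Z ∨ Disjoint (E i) Z) : Z = univ ∨ Z.Finite := by
  rcases interior_eq_univ_or_interior_eq_empty hZ h with h1 | ⟨h0, hiso⟩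
  · exact Or.inl (eq_univ_of_univ_subset (h1.symm.le.trans interior_subset))
  · right
    -- every end is disjoint from `Z`: an open end inside `Z` lies in `interior Z = ∅`
    have hdisj : ∀ i, Disjoint (E i) Z := fun i => (hend i).elim
      (fun hsub => by
        have hEi : E i = ∅ := subset_empty_iff.1 (h0 ▸ interior_maximal hsub (hE i))
        rw [hEi]
        exact empty_disjoint _)
      id
    -- hence `Z ⊆ C`
    have hZC : Z ⊆ C := fun z hz => by
      rcases hcover hz with hzC | hzE
      · exact hzC
      · simp only [mem_iUnion] at hzE
        obtain ⟨i, hzi⟩ := hzE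
        exact absurd hz (Set.disjoint_left.1 (hdisj i) hzi)
    exact Set.Finite.of_isClosed_of_subset_isCompact_of_forall_eventually_not_mem hZ hC hZC hiso

/-- **EVERYTHING OR FINITE, the dichotomy assumed at every point** (then `Z` is automatically closed): on a preconnected space, if every point
has a neighbourhood contained in `Z` or a punctured neighbourhood avoiding `Z`, and `Z ⊆ C ∪ ⋃ᵢ Eᵢ` with `C` compact and open ends `Eᵢ` each
contained in or disjoint from `Z`, then `Z` is the whole space or finite.
[cite: CattaniDeligneKaplan1995, Thm. 1.1, Cor. 1.2 (p. 484) and «Proof of 1.5 ⟹ 1.1» (p. 485)] [cite: FritzscheGrauert2002, Ch. I §8 (after Prop. 8.1, n = 1)] -/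
theorem eq_univ_or_finite_of_forall {X : Type*} [TopologicalSpace X] [PreconnectedSpace X] {Z : Set X}
    (h : ∀ x : X, Z ∈ 𝓝 x ∨ ∀ᶠ y in 𝓝[≠] x, y ∉ Z) {C : Set X} (hC : IsCompact C) {ι : Sort*} {E : ι → Set X}
    (hE : ∀ i, IsOpen (E i)) (hcover : Z ⊆ C ∪ ⋃ i, E i) (hend : ∀ i, E i ⊆ Z ∨ Disjoint (E i) Z) : Z = univ ∨ Z.Finite :=
  eq_univ_or_finite_of_forall_mem_nhds_or_eventually_not_mem (isClosed_of_forall_mem_nhds_or_eventually_not_mem h) (fun x _ => h x) hC hE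
    hcover hend

/-- **A finite union of sets each locally «neighbourhood or punctured-avoided» is again such** (the finite disjoint sum of closed analytic
subspaces: «locally on `S`, `S^{(K)}` is a finite disjoint sum of closed analytic subspaces»).
[cite: CattaniDeligneKaplan1995, §1 (p. 484)] -/
theorem mem_nhds_or_eventually_not_mem_biUnion {α : Type*} {s : Set α} (hs : s.Finite) {A : α → Set X} {x : X}
    (h : ∀ a ∈ s, A a ∈ 𝓝 x ∨ ∀ᶠ y in 𝓝[≠] x, y ∉ A a) :
    (⋃ a ∈ s, A a) ∈ 𝓝 x ∨ ∀ᶠ y in 𝓝[≠] x, y ∉ ⋃ a ∈ s, A a := by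
  by_cases hex : ∃ a ∈ s, A a ∈ 𝓝 x
  · obtain ⟨a, ha, hn⟩ := hex
    exact Or.inl (Filter.mem_of_superset hn (subset_biUnion_of_mem ha))
  · right
    simp only [not_exists, not_and] at hex
    have hall : ∀ a ∈ s, ∀ᶠ y in 𝓝[≠] x, y ∉ A a := fun a ha => (h a ha).resolve_left (hex a ha)
    have hev : ∀ᶠ y in 𝓝[≠] x, ∀ a ∈ s, y ∉ A a := (hs.eventually_all).2 hall
    filter_upwards [hev] with y hy
    simp only [mem_iUnion, not_exists]
    exact fun a ha => hy a ha

/-- A subset of a set locally «neighbourhood or punctured-avoided» at `x`, which coincides with it near `x`… — elementary monotonicity used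
to pass from the model locus to the Hodge locus: if `Z ∩ U = Z′ ∩ U` for a neighbourhood `U` of `x`, the dichotomy transfers from `Z′` to `Z`.
[cite: CattaniDeligneKaplan1995, §1 (p. 484)] -/
theorem mem_nhds_or_eventually_not_mem_congr {Z Z' U : Set X} {x : X} (hU : U ∈ 𝓝 x) (hZZ' : Z ∩ U = Z' ∩ U)
    (h : Z' ∈ 𝓝 x ∨ ∀ᶠ y in 𝓝[≠] x, y ∉ Z') : Z ∈ 𝓝 x ∨ ∀ᶠ y in 𝓝[≠] x, y ∉ Z := by
  rcases h with hn | hiso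
  · left
    have h1 : Z' ∩ U ∈ 𝓝 x := Filter.inter_mem hn hU
    rw [← hZZ'] at h1
    exact Filter.mem_of_superset h1 inter_subset_left
  · right
    have hU' : ∀ᶠ y in 𝓝[≠] x, y ∈ U := mem_nhdsWithin_of_mem_nhds hU
    filter_upwards [hiso, hU'] with y hy hyU hyZ
    have : y ∈ Z' ∩ U := by rw [← hZZ']; exact ⟨hyZ, hyU⟩
    exact hy this.1

/-! ## §5 Several variables: everything or empty interior -/

/-- **For `Z` which, near every point, either contains a neighbourhood of the point or has empty interior there, `interior Z` is CLOPEN**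
(the several-variable form of §1: «the locus … is a complex analytic subspace» — a proper analytic subset of a connected coordinate ball has
empty interior).  Hypothesis at `x`: some `W ∈ 𝓝 x` with `W ⊆ Z` or `interior (Z ∩ W) = ∅`.
[cite: CattaniDeligneKaplan1995, §1 (pp. 483–484)] [cite: FritzscheGrauert2002, Ch. I §8] -/
theorem isClopen_interior_of_forall_exists_mem_nhds {Z : Set X} (h : ∀ x : X, ∃ W ∈ 𝓝 x, W ⊆ Z ∨ interior (Z ∩ W) = ∅) :
    IsClopen (interior Z) := by
  refine ⟨?_, isOpen_interior⟩
  rw [isClosed_iff_clusterPt]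
  intro x hx
  obtain ⟨W, hW, hWZ | hint⟩ := h x
  · exact mem_interior_iff_mem_nhds.2 (Filter.mem_of_superset hW hWZ)
  · -- `interior Z ∩ interior W` is a nonempty open subset of `Z ∩ W`
    exfalso
    rw [clusterPt_principal_iff] at hx
    obtain ⟨y, hyW, hyZ⟩ := hx (interior W) (interior_mem_nhds.2 hW)
    have hy : y ∈ interior (Z ∩ W) := by
      rw [interior_inter]
      exact ⟨hyZ, hyW⟩
    rw [hint] at hy
    exact hy

/-- **EVERYTHING OR EMPTY INTERIOR (any dimension).**  On a preconnected space, a set which near every point contains a neighbourhood of the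
point or has empty interior there is the whole space or has EMPTY INTERIOR — the topology of «locally on `S`, `S^{(K)}` is a finite disjoint sum
of closed analytic subspaces» over a connected base of any dimension: the Hodge locus of bounded norm is everything or nowhere dense.
[cite: CattaniDeligneKaplan1995, §1 (pp. 483–484)] [cite: FritzscheGrauert2002, Ch. I §8] -/
theorem eq_univ_or_interior_eq_empty [PreconnectedSpace X] {Z : Set X} (h : ∀ x : X, ∃ W ∈ 𝓝 x, W ⊆ Z ∨ interior (Z ∩ W) = ∅) :
    Z = univ ∨ interior Z = ∅ := by
  rcases isClopen_iff.1 (isClopen_interior_of_forall_exists_mem_nhds h) with h0 | h1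
  · exact Or.inr h0
  · exact Or.inl (eq_univ_of_univ_subset (h1.symm.le.trans interior_subset))

/-- The closed version: if moreover `Z` is closed, it is the whole space or NOWHERE DENSE. [cite: CattaniDeligneKaplan1995, §1 (pp. 483–484)] -/
theorem eq_univ_or_isNowhereDense [PreconnectedSpace X] {Z : Set X} (hZ : IsClosed Z)
    (h : ∀ x : X, ∃ W ∈ 𝓝 x, W ⊆ Z ∨ interior (Z ∩ W) = ∅) : Z = univ ∨ IsNowhereDense Z := by
  rcases eq_univ_or_interior_eq_empty h with h1 | h0
  · exact Or.inl h1
  · exact Or.inr (hZ.isNowhereDense_iff.2 h0)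

end Literature.Topology
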